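import Mathlib
import Literature.Topology.FourManifolds.SPC4Wave0
import HarnessLib

/-!
# SmoothPoincare4 — problem statement (D-0007: predetermined problem; this file is CREATED BY THE OPERATOR via docs/m5/create_problems.py, never proposed by agents)

Prop-valued definitions (main statement + variants), assembled by the M5 migration from:
* `harness21/H21/H21/Statements/SPC4/Wave0.lean` (1 defs)

Audit 2026-08-13 (refuter-audit-SmoothPoincare4-0): statement unchanged; docstring corrected
(Kirby list numbering, closedness, relation to the homeomorphism form).
-/

-- provenance: harness21/H21/H21/Statements/SPC4/Wave0.lean @ fef268a (interim HEAD d8f2665); M5 mechanical rewrite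
open scoped Manifold ContDiff
open ContinuousMap CategoryTheory

noncomputable section

namespace Literature.SPC4

universe u v

/-- Local notation: `𝔼 n` is the model Euclidean space `EuclideanSpace ℝ (Fin n)`. -/
local notation "𝔼 " n:arg => EuclideanSpace ℝ (Fin n)

/-- Local notation: `𝕊 n` is the unit sphere in `EuclideanSpace ℝ (Fin (n + 1))`, the standard
`n`-sphere with its Mathlib analytic manifold structure. -/
local notation "𝕊 " n:arg => (Metric.sphere (0 : EuclideanSpace ℝ (Fin (n + 1))) 1)

/-! ### spc4.S01, spc4.S02: the peak and its negation -/

/-- **spc4.S01** (smooth 4-dimensional Poincaré conjecture, SPC4; summits/spc4/SUMMIT.md).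
Kirby (ed.), *Problems in low-dimensional topology* (1997), Problem 4.89, verbatim:
"Smooth Poincaré Conjecture: A smooth homotopy 4-sphere Σ is diffeomorphic to S⁴."
(Remarks there: "Σ is homeomorphic to S⁴ [Freedman], so the conjecture is that S⁴ has only one
smooth structure"; the homeomorphism form is Freedman–Gompf–Morrison–Walker 2010, Conj. 1.1.)

Lean form = Mathlib's `ContinuousMap.HomotopyEquiv.NonemptyDiffeomorphSphere M 4`
(`Mathlib/Geometry/Manifold/PoincareConjecture.lean`), closed over all Hausdorff second-countable
`M`: for every such topological space `M`, every `C^∞` atlas on `M` modelled on `ℝ⁴`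
(`ChartedSpace (𝔼 4) M` + `IsManifold (𝓡 4) ∞ M`, boundaryless model), a homotopy equivalence
`M ≃ₕ S⁴` yields a `C^∞` diffeomorphism `M ≃ₘ⟮𝓡 4, 𝓡 4⟯ S⁴` for that atlas. "Closed" is not a
separate hypothesis: a Hausdorff second-countable 4-manifold homotopy equivalent to `S⁴` is compact
(`H₄ ≠ 0`, Hatcher Prop. 3.29; Literature `Literature.Topology.FourManifolds.compactSpace_of_homotopyEquiv_sphere_four`) and has
empty boundary (charts into open subsets of `ℝ⁴`). Universe fixed to `Type` at the root name.
Open. [cite: Kirby1997, Problem 4.89] [problem: spc4] -/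
def SmoothPoincareConjectureFour : Prop :=
  ∀ (M : Type u) [TopologicalSpace M] [T2Space M] [SecondCountableTopology M],
    HomotopyEquiv.NonemptyDiffeomorphSphere M 4

/-! ### spc4.S10: homotopy 4-spheres via `π₁` and `H₂` -/

/-! ### spc4.S11, spc4.S12: exotic `ℝ⁴` and exotic `S⁷` -/

/-! ### spc4.S32: dimensions in which the smooth Poincaré conjecture holds / fails -/

/-! ### spc4.S33: smoothing theory in dimension `≤ 3` -/

/-! ### spc4.S20, spc4.S34: two open siblings -/

end Literature.SPC4

/-- The `SmoothPoincare4` problem statement (D-0010; canonical root-level name checked by the gate) := `Literature.SPC4.SmoothPoincareConjectureFour`. [problem: spc4] -/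
def SmoothPoincare4 : Prop := Literature.SPC4.SmoothPoincareConjectureFour.{0}
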